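import Summits.NavierStokesRegularity.FunctionalMining.StretchingNestedTargets
import HarnessLib

/-!
# FunctionalMining — K1-Q1: the bank's SINGLE-WRAP FORMULA `sup_Λ R(Λ;F) = [π_F + √(π_F² + g_F² e_F/2)]/(2e_F)` in the kernel (dict seat, staged)

NS FUNCTIONAL MINING cell (`pub-nsfunc`), dictionary seat gen 7 — **search for candidate a priori
estimates; no regularity claim.** STATIC field inequalities only: nothing about Navier–Stokes solutions
is asserted anywhere in this file.

Bank K1Q1-HALF §9.4 (04:44Z, hand): for a filler `F` with production `π_F`, enstrophy `e_F`, moment gap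
`g_F = T_ext − T_comp` (self-ratio `r_F = π_F/e_F`, anisotropy `a = g_F/(2e_F)`), the wrap ratio
`R(Λ;F) = (Λ g_F + π_F)/(2Λ² + e_F)` of the staged node `WrapLowerBound` (dict (w)) satisfies
`sup_Λ R(Λ;F) = [r_F + √(r_F² + 2a²e_F)]/2 = [π_F + √(π_F² + g_F² e_F/2)]/(2e_F)`, attained at
`Λ⋆ = [−π_F + √(π_F² + g_F² e_F/2)]/g_F ≤ 1/2`.
This file PROVES that algebra (for real parameters: the bound `R(Λ) ≤ R⋆` for EVERY real `Λ` — the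
defect is a perfect square — and the attainment `R(Λ⋆) = R⋆`, `0 < Λ⋆ ≤ 1/2` when `π ≥ 0`, `0 < e ≤ 1/2`,
`g > 0`), the dictionary lemma `e_F ≤ M²/2` under `|ω|² ≤ M²` (so `|Ω_F| ≤ 1 ⇒ e_F ≤ 1/2 ⇒ Λ⋆ ≤ 1/2`), and
the conditional kernel theorem **`WrapLowerBound → [π_F + √(π_F² + g_F² e_F/2)]/(2e_F) ≤ C⋆`** for every
smooth divergence-free filler with `|Ω_F|² ≤ 1`, `e_F > 0`, `g_F > 0`, `π_F ≥ 0` (bank checks: 2½-D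
statistics `(1/4, 1/2, 1/4) ⇒ (2+√5)/8`; tubes-only `(0, 1/2, 1) ⇒ 1/2`). The node itself (bank
THEOREM 3) is NOT proved here. [ours; internal, not literature]
-/

noncomputable section

open Set Filter Topology MeasureTheory

namespace Summit.NavierStokesRegularity.FunctionalMining

open Literature.Analysis Literature.Analysis.FunctionSpaces Literature.Analysis.FunctionSpaces.Torus
open Literature.Analysis.FluidPDE

variable {d : Type*} [Fintype d] [DecidableEq d]

/-! ## 1. Dictionary lemma: `|ω|² ≤ M²` pointwise ⇒ `ℰ ≤ M²/2` -/

/-- `x ↦ |ω(x)|²` is smooth for a smooth field. [ours; bookkeeping] -/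
theorem isSmooth_torusVorticitySqAt {v : UnitAddTorus d → EuclideanSpace ℝ d} (hv : Torus.IsSmooth v) :
    Torus.IsSmooth (torusVorticitySqAt v) := by
  have hDc : ∀ m j, Torus.IsSmooth (fun y => Torus.partialDeriv m v y j) :=
    fun m j => (hv.partialDeriv m).apply j
  have h : ∀ i j, Torus.IsSmooth (fun x =>
      ((Torus.partialDeriv i v x) j - (Torus.partialDeriv j v x) i) ^ 2) :=
    fun i j => ((hDc i j).sub (hDc j i)).pow 2
  have hsum : Torus.IsSmooth (fun x => ∑ i, ∑ j,
      ((Torus.partialDeriv i v x) j - (Torus.partialDeriv j v x) i) ^ 2) := by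
    unfold Torus.IsSmooth at h ⊢
    exact ContDiff.sum fun i _ => ContDiff.sum fun j _ => h i j
  have : torusVorticitySqAt v = fun x => 2⁻¹ * ∑ i, ∑ j,
      ((Torus.partialDeriv i v x) j - (Torus.partialDeriv j v x) i) ^ 2 := rfl
  rw [this]
  exact hsum.smul 2⁻¹

/-- **`|ω|² ≤ M²` pointwise ⇒ `ℰ(v) ≤ M²/2`** for smooth divergence-free `v` on the unit torus
(`∫|ω|² = 2ℰ`, unit volume). In K1-Q1 terms: a filler with `|Ω_F| ≤ 1` has `e_F ≤ 1/2`.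
Search for candidate a priori estimates; no regularity claim. [ours] -/
theorem torusEnstrophy_le_of_vorticitySq_le {v : UnitAddTorus d → EuclideanSpace ℝ d}
    (hv : Torus.IsSmooth v) (hdiv : Torus.IsDivFree v) {M : ℝ}
    (hω : ∀ x, torusVorticitySqAt v x ≤ M ^ 2) : torusEnstrophy v ≤ M ^ 2 / 2 := by
  have hint : ∫ x, torusVorticitySqAt v x ≤ ∫ _ : UnitAddTorus d, M ^ 2 :=
    integral_mono (isSmooth_torusVorticitySqAt hv).integrable (integrable_const _) hω
  rw [integral_torusVorticitySqAt_eq_two_mul_torusEnstrophy hv hdiv, integral_const, smul_eq_mul] at hint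
  have h1 : (volume : Measure (UnitAddTorus d)).real univ = 1 := by simp [Measure.real]
  rw [h1, one_mul] at hint
  linarith

/-! ## 2. The single-wrap algebra over real parameters -/

/-- `R(Λ; π, e, g) := (Λg + π)/(2(Λ² + e/2))` — the wrap ratio as a function of the statistics. [ours] -/
def wrapR (Λ π e g : ℝ) : ℝ := (Λ * g + π) / (2 * (Λ ^ 2 + e / 2))

/-- `s(π, e, g) := √(π² + g²e/2)`. [ours] -/
def wrapDisc (π e g : ℝ) : ℝ := Real.sqrt (π ^ 2 + g ^ 2 * e / 2)

/-- The optimal strain amplitude `Λ⋆ := (−π + √(π² + g²e/2))/g`. [ours] -/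
def wrapLamOpt (π e g : ℝ) : ℝ := (wrapDisc π e g - π) / g

/-- The single-wrap value `R⋆ := (π + √(π² + g²e/2))/(2e)` (`= [r + √(r² + 2a²e)]/2` with `r = π/e`,
`a = g/(2e)`, bank §9.4). [ours] -/
def wrapSup (π e g : ℝ) : ℝ := (π + wrapDisc π e g) / (2 * e)

/-- `wrapDisc_nonneg` (bookkeeping). [ours; elementary] -/
theorem wrapDisc_nonneg (π e g : ℝ) : 0 ≤ wrapDisc π e g := Real.sqrt_nonneg _

/-- `wrapDisc_sq` (bookkeeping). [ours; elementary] -/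
theorem wrapDisc_sq {π e g : ℝ} (he : 0 ≤ e) : wrapDisc π e g ^ 2 = π ^ 2 + g ^ 2 * e / 2 :=
  Real.sq_sqrt (by positivity)

/-- `|π| < s` as soon as `g²e > 0`. [ours; elementary] -/
theorem lt_wrapDisc {π e g : ℝ} (he : 0 < e) (hg : 0 < g) : π < wrapDisc π e g := by
  have hs := wrapDisc_nonneg π e g
  have hs2 := wrapDisc_sq (π := π) (g := g) he.le
  by_contra h
  rw [not_lt] at h
  nlinarith [mul_pos (pow_pos hg 2) he]

/-- `0 < Λ⋆`. [ours; elementary] -/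
theorem wrapLamOpt_pos {π e g : ℝ} (he : 0 < e) (hg : 0 < g) : 0 < wrapLamOpt π e g :=
  div_pos (sub_pos.2 (lt_wrapDisc he hg)) hg

/-- `Λ⋆ ≤ 1/2` when `π ≥ 0` and `e ≤ 1/2` (bank §9.4: "Λ⋆ ≤ ½"). [ours; elementary] -/
theorem wrapLamOpt_le_half {π e g : ℝ} (hπ : 0 ≤ π) (he : 0 < e) (he' : e ≤ 1 / 2) (hg : 0 < g) :
    wrapLamOpt π e g ≤ 1 / 2 := by
  unfold wrapLamOpt
  rw [div_le_iff₀ hg]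
  have hs := wrapDisc_nonneg π e g
  have hs2 := wrapDisc_sq (π := π) (g := g) he.le
  nlinarith [mul_nonneg hπ hg.le, mul_nonneg (pow_pos hg 2).le (by linarith : (0 : ℝ) ≤ 1 / 2 - e)]

/-- **`R(Λ) ≤ R⋆` for EVERY real `Λ`** (the defect `(π+s)(2Λ²+e) − 2e(Λg+π)` is the perfect square
`(2(π+s)Λ − eg)²/(2(π+s))`). [ours; elementary] -/
theorem wrapR_le_wrapSup {π e g : ℝ} (hπ : 0 ≤ π) (he : 0 < e) (hg : 0 < g) (Λ : ℝ) :
    wrapR Λ π e g ≤ wrapSup π e g := by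
  have hs := wrapDisc_nonneg π e g
  have hs2 := wrapDisc_sq (π := π) (g := g) he.le
  have hπs : 0 < π + wrapDisc π e g := by linarith [lt_wrapDisc (π := π) he hg]
  unfold wrapR wrapSup
  rw [div_le_div_iff₀ (by positivity) (by positivity)]
  nlinarith [sq_nonneg (2 * (π + wrapDisc π e g) * Λ - e * g), hπs]

/-- **`R(Λ⋆) = R⋆`** (attainment). [ours; elementary] -/
theorem wrapR_wrapLamOpt {π e g : ℝ} (he : 0 < e) (hg : 0 < g) :
    wrapR (wrapLamOpt π e g) π e g = wrapSup π e g := by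
  have hs := wrapDisc_nonneg π e g
  have hs2 := wrapDisc_sq (π := π) (g := g) he.le
  have hsp : 0 < wrapDisc π e g - π := sub_pos.2 (lt_wrapDisc he hg)
  unfold wrapR wrapSup wrapLamOpt
  have hden : 0 < 2 * (((wrapDisc π e g - π) / g) ^ 2 + e / 2) := by positivity
  rw [div_eq_div_iff hden.ne' (by positivity)]
  field_simp
  nlinarith [hs2, hsp, mul_pos hsp he, mul_pos (mul_pos hsp he) (pow_pos hg 2)]

/-! ## 3. The conditional kernel theorem -/

/-- The vorticity second-moment GAP `g_F := T₁₁(F) − T₂₂(F)` (0-indexed; bank `T₂₂ − T₃₃`). [ours] -/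
def momentGap (F : UnitAddTorus (Fin 3) → EuclideanSpace ℝ (Fin 3)) : ℝ :=
  vorticityMoment F 1 1 - vorticityMoment F 2 2

/-- `wrapRatio_eq_wrapR` (bookkeeping). [ours; elementary] -/
theorem wrapRatio_eq_wrapR (Λ : ℝ) (F : UnitAddTorus (Fin 3) → EuclideanSpace ℝ (Fin 3)) :
    wrapRatio Λ F = wrapR Λ (enstrophyProduction F) (torusEnstrophy F) (momentGap F) := rfl

/-- **SINGLE-WRAP BOUND (bank K1Q1-HALF §9.4) in the kernel, conditionally on the node `WrapLowerBound`
(bank THEOREM 3, unproved here):** for every smooth divergence-free filler `F` on `T³` with `|Ω_F|² ≤ 1`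
pointwise, `e_F > 0`, `g_F > 0`, `π_F ≥ 0`,
`[π_F + √(π_F² + g_F² e_F/2)]/(2e_F) ≤ C⋆` — i.e. `[r_F + √(r_F² + 2a²e_F)]/2 ≤ C⋆`.
Search for candidate a priori estimates; no regularity claim. [ours] -/
theorem wrapSup_le_stretchingSupConst (hW : WrapLowerBound)
    {F : UnitAddTorus (Fin 3) → EuclideanSpace ℝ (Fin 3)} (hF : Torus.IsSmooth F)
    (hdiv : Torus.IsDivFree F) (hω : ∀ x, torusVorticitySqAt F x ≤ 1)
    (he : 0 < torusEnstrophy F) (hg : 0 < momentGap F) (hπ : 0 ≤ enstrophyProduction F) :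
    wrapSup (enstrophyProduction F) (torusEnstrophy F) (momentGap F) ≤ stretchingSupConst (d := Fin 3) := by
  have he' : torusEnstrophy F ≤ 1 / 2 := by
    have := torusEnstrophy_le_of_vorticitySq_le hF hdiv (M := 1) (fun x => by rw [one_pow]; exact hω x)
    linarith
  have h := hW F hF hdiv hω _ (wrapLamOpt_pos he hg) (wrapLamOpt_le_half hπ he he' hg)
  rwa [wrapRatio_eq_wrapR, wrapR_wrapLamOpt he hg] at h

/-- Optimality of the single wrap: no choice of `Λ` does better than `R⋆` (so the bank's saturation
`≈ 0.531` of board + 2½-D-filler wraps is a property of the FILLER statistics, not of a poor `Λ`).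
[ours; elementary] -/
theorem wrapRatio_le_wrapSup {F : UnitAddTorus (Fin 3) → EuclideanSpace ℝ (Fin 3)}
    (he : 0 < torusEnstrophy F) (hg : 0 < momentGap F) (hπ : 0 ≤ enstrophyProduction F) (Λ : ℝ) :
    wrapRatio Λ F ≤ wrapSup (enstrophyProduction F) (torusEnstrophy F) (momentGap F) := by
  rw [wrapRatio_eq_wrapR]; exact wrapR_le_wrapSup hπ he hg Λ

/-! ## 4. The bank's two checks of the formula -/

/-- 2½-D filler statistics `(π, e, g) = (1/4, 1/2, 1/4)` ⇒ `R⋆ = (2+√5)/8` (bank §9.4 check 1; agrees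
with dict (w) `wrapFloor_zero`). [ours; elementary] -/
theorem wrapSup_planar : wrapSup (1 / 4) (1 / 2) (1 / 4) = (2 + Real.sqrt 5) / 8 := by
  unfold wrapSup wrapDisc
  have h : Real.sqrt ((1 / 4 : ℝ) ^ 2 + (1 / 4) ^ 2 * (1 / 2) / 2) = Real.sqrt 5 / 8 := by
    rw [show ((1 / 4 : ℝ) ^ 2 + (1 / 4) ^ 2 * (1 / 2) / 2) = 5 / 8 ^ 2 by norm_num,
      Real.sqrt_div' _ (by norm_num), Real.sqrt_sq (by norm_num)]
  rw [h]; ring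

/-- Tubes-only filler statistics `(π, e, g) = (0, 1/2, 1)` ⇒ `R⋆ = 1/2` (bank §9.4 check 2).
[ours; elementary] -/
theorem wrapSup_tubes : wrapSup 0 (1 / 2) 1 = 1 / 2 := by
  unfold wrapSup wrapDisc
  have h : Real.sqrt ((0 : ℝ) ^ 2 + 1 ^ 2 * (1 / 2) / 2) = 1 / 2 := by
    rw [show ((0 : ℝ) ^ 2 + 1 ^ 2 * (1 / 2) / 2) = (1 / 2) ^ 2 by norm_num, Real.sqrt_sq (by norm_num)]
  rw [h]; norm_num

end Summit.NavierStokesRegularity.FunctionalMining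

end
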